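import Mathlib
import HarnessLib
import Summits.HubbardSuperconductivity.HubbardSuperconductivity.Theorems.KLProgrammeKLRegimeSplitBundleV11

/-!
# Route `KLProgramme` — crux K3 `KLRegimeTwoPointLimit` (stmt-HubbardSuperconductivity-19937): the two-leg slot, the history and the bundle
# GENERIC IN THE ENGINE SLOT (`histE E`, `TwoLegStepE E`, `klPredsE E`) — re-packaging only, no slot text changes
# (seat hubbard-kl-k3c5-p1 g3; gen-4 port design, HOME/STATUS 2026-08-26 ≈21:50Z)

Every defect repaired inside the ENGINE slot (Δ19 `EngineBoundsAtV5S → V7S`, gen 4's Δ21 `PairLadderStepAtV7 → V8`, …) so far forced a verbatim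
re-typing of the two-leg slot, the history and every downstream child-2 / child-5 module, because those texts NAME the engine predicate although
they never look inside it: the comparison-frame history is `split ∧ renorm ∧ engine`, and the two-leg slot is
`TwoLegStepG (that history) ∧ TwoLegSizesMS ∧ TwoLegAngularG ∧ TwoLegVolumeRate (history ∧ TwoLegStepG ∧ TwoLegSizesMS ∧ TwoLegAngularG)`.

This module abstracts the engine predicate into a parameter `E : EngSlot` (the type of `Preds.engine`):

* `histE E` — the comparison-frame / comparison-volume history `BetaSplitAtS2 ∧ RenormalisedAtF ∧ E`;
* `TwoLegStepE E` — V11's two-leg slot read at `histE E` (conjunct order VERBATIM);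
* `klPredsE E : Preds := { frameOK := FrameOK, renorm := RenormalisedAtF, split := BetaSplitAtS2, engine := E, twoLeg := TwoLegStepE E }`;
* bookkeeping: **`histV10 = histE EngineBoundsAtV7S`, `TwoLegStepV11 = TwoLegStepE EngineBoundsAtV7S`, `klPredsV11 = klPredsE EngineBoundsAtV7S`,
  all by `rfl`** — so every theorem landed on `klPredsV11` is literally a theorem about `klPredsE EngineBoundsAtV7S`, and a future bundle that only
  changes the engine slot (`klPredsV12 := klPredsE EngineBoundsAtV8S` if typed in this shape) inherits every `E`-generic child theorem by
  instantiation; component accessors `twoLegStepG_of_twoLegStepE` / `twoLegSizesMS_of_twoLegStepE` / `twoLegAngularG_of_twoLegStepE` /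
  `twoLegVolumeRate_of_twoLegStepE`, and `histE_of_histP` (the bundle's own `HistP` discharges the history at any volume).

Definitions + `rfl`/projection bookkeeping only; nothing is asserted about the Hubbard model.
-/

noncomputable section

namespace Summit.HubbardSuperconductivity.HubbardSuperconductivity.Theorems.KLRegimeSplit

set_option linter.dupNamespace false -- summit = problem name (single-conjunct summit), D-0017

open Real Finset Literature.MathematicalPhysics.QuantumLattice Literature.Probability.LatticeModels
open Summit.HubbardSuperconductivity.HubbardSuperconductivity.Theorems.KLProgrammeLegKernels

/-- **The type of an engine-slot predicate** `E L M G P Q β U μ K n` (= the type of the field `Preds.engine`). -/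
abbrev EngSlot : Type :=
  (L M : ℕ) → [NeZero L] → [NeZero M] → GeoConsts → SplitConsts → EngConsts → ℝ → ℝ → ℝ → TrigPolyC4v → ℕ → Prop

section Model

variable (L M : ℕ) [NeZero L] [NeZero M]

/-- **The comparison-frame / comparison-volume history for the engine slot `E`** at scale `j`: `BetaSplitAtS2 ∧ RenormalisedAtF ∧ E`
(`histV10` with `EngineBoundsAtV7S` abstracted). -/
def histE (E : EngSlot) (G : GeoConsts) (P : SplitConsts) (Q : EngConsts) (R : RenConsts) (β U μ : ℝ) : TrigPolyC4v → ℕ → Prop :=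
  fun K' j => BetaSplitAtS2 L M G P Q β U μ K' j ∧ RenormalisedAtF L M β U μ K' R j ∧ E L M G P Q β U μ K' j

/-- **The two-leg slot for the engine slot `E`** := `TwoLegStepG (histE E) ∧ TwoLegSizesMS ∧ TwoLegAngularG ∧
TwoLegVolumeRate (histE E ∧ TwoLegStepG (histE E) ∧ TwoLegSizesMS ∧ TwoLegAngularG)` — `TwoLegStepV11`'s text with `histV10` replaced by `histE E`,
conjunct order verbatim. -/
def TwoLegStepE (E : EngSlot) (G : GeoConsts) (P : SplitConsts) (Q : EngConsts) (R : RenConsts) (β U μ : ℝ) (K : TrigPolyC4v) (n : ℕ) :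
    Prop :=
  TwoLegStepG L M (histE L M E G P Q R β U μ) G P Q R β U μ K n ∧ TwoLegSizesMS L M G Q R β U μ K n ∧
    TwoLegAngularG L M G Q R β U μ K n ∧
      TwoLegVolumeRate L M
        (fun L' M' _ _ K' j => histE L' M' E G P Q R β U μ K' j ∧
          TwoLegStepG L' M' (histE L' M' E G P Q R β U μ) G P Q R β U μ K' j ∧ TwoLegSizesMS L' M' G Q R β U μ K' j ∧
            TwoLegAngularG L' M' G Q R β U μ K' j)
        Q β U μ K n

end Model

/-- **The bundle for the engine slot `E`** := `{ frameOK := FrameOK, renorm := RenormalisedAtF, split := BetaSplitAtS2, engine := E,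
twoLeg := TwoLegStepE E }` (`klPredsV11`'s text with the engine predicate abstracted). -/
def klPredsE (E : EngSlot) : Preds where
  frameOK := FrameOK
  renorm := fun L M _ _ β U μ K R n => RenormalisedAtF L M β U μ K R n
  split := fun L M _ _ G P Q β U μ K n => BetaSplitAtS2 L M G P Q β U μ K n
  engine := fun L M _ _ G P Q β U μ K n => E L M G P Q β U μ K n
  twoLeg := fun L M _ _ G P Q R β U μ K n => TwoLegStepE L M E G P Q R β U μ K n

/-! ## Bookkeeping: V11 IS the `EngineBoundsAtV7S` instance (`rfl`-level) -/

/-- `histV10 = histE EngineBoundsAtV7S`. -/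
theorem histV10_eq_histE (L M : ℕ) [NeZero L] [NeZero M] (G : GeoConsts) (P : SplitConsts) (Q : EngConsts) (R : RenConsts) (β U μ : ℝ) :
    histV10 L M G P Q R β U μ = histE L M EngineBoundsAtV7S G P Q R β U μ := rfl

/-- `TwoLegStepV11 = TwoLegStepE EngineBoundsAtV7S`. -/
theorem twoLegStepV11_eq_twoLegStepE (L M : ℕ) [NeZero L] [NeZero M] (G : GeoConsts) (P : SplitConsts) (Q : EngConsts) (R : RenConsts)
    (β U μ : ℝ) (K : TrigPolyC4v) (n : ℕ) :
    TwoLegStepV11 L M G P Q R β U μ K n = TwoLegStepE L M EngineBoundsAtV7S G P Q R β U μ K n := rfl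

/-- **`klPredsV11 = klPredsE EngineBoundsAtV7S`** — every theorem about the V11 bundle is a theorem about the `E`-generic bundle at
`E := EngineBoundsAtV7S`, and conversely. -/
theorem klPredsV11_eq_klPredsE : klPredsV11 = klPredsE EngineBoundsAtV7S := rfl

/-- The `E`-generic bundle's frame class is `FrameOK`. -/
theorem klPredsE_frameOK (E : EngSlot) : (klPredsE E).frameOK = FrameOK := rfl

/-- The `E`-generic bundle's renormalisation slot is `RenormalisedAtF`. -/
theorem klPredsE_renorm_apply (E : EngSlot) (L M : ℕ) [NeZero L] [NeZero M] (β U μ : ℝ) (K : TrigPolyC4v) (R : RenConsts) (n : ℕ) :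
    (klPredsE E).renorm L M β U μ K R n = RenormalisedAtF L M β U μ K R n := rfl

/-- The `E`-generic bundle's split slot is `BetaSplitAtS2`. -/
theorem klPredsE_split_apply (E : EngSlot) (L M : ℕ) [NeZero L] [NeZero M] (G : GeoConsts) (P : SplitConsts) (Q : EngConsts) (β U μ : ℝ)
    (K : TrigPolyC4v) (n : ℕ) : (klPredsE E).split L M G P Q β U μ K n = BetaSplitAtS2 L M G P Q β U μ K n := rfl

/-- The `E`-generic bundle's engine slot is `E`. -/
theorem klPredsE_engine_apply (E : EngSlot) (L M : ℕ) [NeZero L] [NeZero M] (G : GeoConsts) (P : SplitConsts) (Q : EngConsts) (β U μ : ℝ)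
    (K : TrigPolyC4v) (n : ℕ) : (klPredsE E).engine L M G P Q β U μ K n = E L M G P Q β U μ K n := rfl

/-- The `E`-generic bundle's two-leg slot is `TwoLegStepE E`. -/
theorem klPredsE_twoLeg_apply (E : EngSlot) (L M : ℕ) [NeZero L] [NeZero M] (G : GeoConsts) (P : SplitConsts) (Q : EngConsts)
    (R : RenConsts) (β U μ : ℝ) (K : TrigPolyC4v) (n : ℕ) :
    (klPredsE E).twoLeg L M G P Q R β U μ K n = TwoLegStepE L M E G P Q R β U μ K n := rfl

section Model

variable {L M : ℕ} [NeZero L] [NeZero M] {E : EngSlot} {G : GeoConsts} {P : SplitConsts} {Q : EngConsts} {R : RenConsts} {β U μ : ℝ}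
  {K : TrigPolyC4v} {n : ℕ}

/-- The «G» two-leg step (at the history `histE E`) is the first conjunct of the `E`-generic two-leg slot. -/
theorem twoLegStepG_of_twoLegStepE (h : TwoLegStepE L M E G P Q R β U μ K n) :
    TwoLegStepG L M (histE L M E G P Q R β U μ) G P Q R β U μ K n := h.1

/-- (E3a-MS) is the second conjunct of the `E`-generic two-leg slot. -/
theorem twoLegSizesMS_of_twoLegStepE (h : TwoLegStepE L M E G P Q R β U μ K n) : TwoLegSizesMS L M G Q R β U μ K n := h.2.1

/-- (E3g) is the third conjunct of the `E`-generic two-leg slot. -/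
theorem twoLegAngularG_of_twoLegStepE (h : TwoLegStepE L M E G P Q R β U μ K n) : TwoLegAngularG L M G Q R β U μ K n := h.2.2.1

/-- The volume-rate conjunct (E3f) of the `E`-generic two-leg slot, with its antecedent at the comparison volume. -/
theorem twoLegVolumeRate_of_twoLegStepE (h : TwoLegStepE L M E G P Q R β U μ K n) :
    TwoLegVolumeRate L M
      (fun L' M' _ _ K' j => histE L' M' E G P Q R β U μ K' j ∧
        TwoLegStepG L' M' (histE L' M' E G P Q R β U μ) G P Q R β U μ K' j ∧ TwoLegSizesMS L' M' G Q R β U μ K' j ∧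
          TwoLegAngularG L' M' G Q R β U μ K' j)
      Q β U μ K n := h.2.2.2

/-- **The bundle's own slots discharge `histE E`**: split ∧ renorm ∧ engine at scale `j` give `histE E … K′ j` — the comparison-frame history
is the bundle's `split ∧ renorm ∧ engine` at that scale (so `HistP (klPredsE E)` discharges it at any volume). -/
theorem histE_of_slots {K' : TrigPolyC4v} {j : ℕ} (hs : BetaSplitAtS2 L M G P Q β U μ K' j) (hr : RenormalisedAtF L M β U μ K' R j)
    (he : E L M G P Q β U μ K' j) : histE L M E G P Q R β U μ K' j := ⟨hs, hr, he⟩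

end Model

end Summit.HubbardSuperconductivity.HubbardSuperconductivity.Theorems.KLRegimeSplit

end
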